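import Summits.KontsevichZagierPeriods.KontsevichZagierPeriods.Theorems.RootDecompWalshStrataEulerDescent06

/-!
# Conic descent, gen 6 (L4 one-variable Euler descent `[T, R(x)·√(ex²+fx+g)^{±1}] ∈ InBaker`), part 7/12

Declarations `integrableOn_deriv_two_sqrt` … `eval_prodX_ne_zero` of the farm-checked gen-6 monolith; see the module docstring of
`EulerDescent01` (part 1) for the overview, the design and the sources. [KontsevichZagier2001 §1.1–1.2; BCR1998 §2.2; Euler 1768; this node gen 4 `sqrtDescent_*`]
-/

noncomputable section

open Literature.NumberTheory.Transcendental
open MeasureTheory Set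
open MvPolynomial (aeval)
open Literature.ModelTheory.ExponentialFields (IsSemialgebraic isSemialgebraic_univ
  isSemialgebraic_setOf_eval_pos isSemialgebraic_setOf_eval_lt isSemialgebraic_setOf_eval_le
  isSemialgebraic_setOf_eval_nonneg isSemialgebraic_setOf_eval_eq_zero continuous_aeval_real
  tarski_seidenberg_real_holds)

namespace Summit.KontsevichZagierPeriods.RootDecompWalshStrata.ConicDescent

/-- The derivative of a monotone or antitone `2√D` is integrable on a compact interval
(`MonotoneOn.intervalIntegrable_deriv`, Lebesgue). [folklore] -/
theorem integrableOn_deriv_two_sqrt (e f g : ℚ) {p q : ℝ} (hpq : p ≤ q)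
    (hmono : MonotoneOn (fun x => 2 * √(qD e f g x)) (Icc p q) ∨
      AntitoneOn (fun x => 2 * √(qD e f g x)) (Icc p q)) :
    IntegrableOn (deriv fun x => 2 * √(qD e f g x)) (Icc p q) := by
  have hI : IntervalIntegrable (deriv fun x => 2 * √(qD e f g x)) volume p q := by
    rcases hmono with h | h
    · exact (show MonotoneOn _ (uIcc p q) by rwa [uIcc_of_le hpq]).intervalIntegrable_deriv
    · have h' : MonotoneOn (-fun x => 2 * √(qD e f g x)) (uIcc p q) := by
        rw [uIcc_of_le hpq]
        intro a ha b hb hab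
        simp only [Pi.neg_apply, neg_le_neg_iff]
        exact h ha hb hab
      have h2 := h'.intervalIntegrable_deriv
      rw [deriv.neg'] at h2
      convert h2.neg using 1
      ext x
      simp only [Pi.neg_apply, neg_neg]
  exact (intervalIntegrable_iff_integrableOn_Icc_of_le hpq).1 hI

/-- The quadratic is monotone on each side of its vertex (or everywhere if `e = 0`). -/
theorem qD_sub_eq (e f g : ℚ) (a b : ℝ) :
    qD e f g b - qD e f g a = (b - a) * ((e : ℝ) * (a + b) + f) := by
  simp only [qD]; ring

/-- **Integrability of `|D′|/√D`** on `{D > 0} ∩ [lo, hi]`: it is `|(2√D)′|` there, and `2√D` is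
continuous and piecewise monotone (two pieces, split at the vertex). [folklore] -/
theorem integrableOn_absDeriv_div_sqrt (e f g : ℚ) (lo hi : ℝ) :
    IntegrableOn (fun x => |2 * (e : ℝ) * x + f| / √(qD e f g x))
      ({x | 0 < qD e f g x} ∩ Icc lo hi) := by
  have hder : IntegrableOn (deriv fun x => 2 * √(qD e f g x)) (Icc lo hi) := by
    by_cases he : e = 0
    · -- linear (or constant) radicand: monotone or antitone on the whole line
      have hI := integrableOn_deriv_two_sqrt e f g (min_le_max : min lo hi ≤ max lo hi)
        (by
          have he' : (e : ℝ) = 0 := by exact_mod_cast he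
          rcases le_or_gt 0 f with hf | hf
          · left
            refine two_sqrt_monotoneOn e f g fun a _ b _ hab => ?_
            have hf' : (0 : ℝ) ≤ f := by exact_mod_cast hf
            have key := qD_sub_eq e f g a b
            rw [he', zero_mul, zero_add] at key
            nlinarith [key, mul_nonneg (sub_nonneg.2 hab) hf']
          · right
            refine two_sqrt_antitoneOn e f g fun a _ b _ hab => ?_
            have hf' : (f : ℝ) ≤ 0 := by exact_mod_cast hf.le
            have key := qD_sub_eq e f g a b
            rw [he', zero_mul, zero_add] at key
            nlinarith [key, mul_nonneg (sub_nonneg.2 hab) (neg_nonneg.2 hf')])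
      exact hI.mono_set (Icc_subset_Icc (min_le_left _ _) (le_max_right _ _))
    · obtain ⟨x₀, hx₀def⟩ : ∃ x₀ : ℝ, x₀ = ((-f / (2 * e) : ℚ) : ℝ) := ⟨_, rfl⟩
      have he' : (e : ℝ) ≠ 0 := by exact_mod_cast he
      have hx₀ : 2 * (e : ℝ) * x₀ = -f := by rw [hx₀def]; push_cast; field_simp
      -- right of the vertex
      have hR : IntegrableOn (deriv fun x => 2 * √(qD e f g x)) (Icc x₀ (max x₀ hi)) := by
        refine integrableOn_deriv_two_sqrt e f g (le_max_left _ _) ?_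
        rcases lt_or_gt_of_ne he with hlt | hgt
        · right
          refine two_sqrt_antitoneOn e f g fun a ha b hb hab => ?_
          have hlt' : (e : ℝ) < 0 := by exact_mod_cast hlt
          have h1 : (e : ℝ) * (a + b) + f ≤ 0 := by nlinarith [ha.1, hb.1]
          nlinarith [qD_sub_eq e f g a b, mul_nonpos_iff.2 (Or.inl ⟨sub_nonneg.2 hab, h1⟩)]
        · left
          refine two_sqrt_monotoneOn e f g fun a ha b hb hab => ?_
          have hgt' : (0 : ℝ) < e := by exact_mod_cast hgt
          have h1 : 0 ≤ (e : ℝ) * (a + b) + f := by nlinarith [ha.1, hb.1]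
          nlinarith [qD_sub_eq e f g a b, mul_nonneg (sub_nonneg.2 hab) h1]
      -- left of the vertex
      have hL : IntegrableOn (deriv fun x => 2 * √(qD e f g x)) (Icc (min lo x₀) x₀) := by
        refine integrableOn_deriv_two_sqrt e f g (min_le_right _ _) ?_
        rcases lt_or_gt_of_ne he with hlt | hgt
        · left
          refine two_sqrt_monotoneOn e f g fun a ha b hb hab => ?_
          have hlt' : (e : ℝ) < 0 := by exact_mod_cast hlt
          have h1 : 0 ≤ (e : ℝ) * (a + b) + f := by nlinarith [ha.2, hb.2]
          nlinarith [qD_sub_eq e f g a b, mul_nonneg (sub_nonneg.2 hab) h1]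
        · right
          refine two_sqrt_antitoneOn e f g fun a ha b hb hab => ?_
          have hgt' : (0 : ℝ) < e := by exact_mod_cast hgt
          have h1 : (e : ℝ) * (a + b) + f ≤ 0 := by nlinarith [ha.2, hb.2]
          nlinarith [qD_sub_eq e f g a b, mul_nonpos_iff.2 (Or.inl ⟨sub_nonneg.2 hab, h1⟩)]
      refine (hL.union hR).mono_set fun x hx => ?_
      rcases le_total x x₀ with h | h
      · exact Or.inl ⟨min_le_of_left_le hx.1, h⟩
      · exact Or.inr ⟨h, le_max_of_le_right hx.2⟩
  have hcont : Continuous fun x : ℝ => qD e f g x := by unfold qD; fun_prop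
  have hS : MeasurableSet ({x | 0 < qD e f g x} ∩ Icc lo hi) :=
    (isOpen_lt continuous_const hcont).measurableSet.inter measurableSet_Icc
  have hn : IntegrableOn (fun x => ‖deriv (fun y => 2 * √(qD e f g y)) x‖)
      ({x | 0 < qD e f g x} ∩ Icc lo hi) := (hder.mono_set inter_subset_right).norm
  refine hn.congr_fun (fun x hx => ?_) hS
  have hD : 0 < qD e f g x := hx.1
  have hs : 0 < √(qD e f g x) := Real.sqrt_pos.2 hD
  have hd : HasDerivAt (fun y => 2 * √(qD e f g y))
      (2 * ((2 * (e : ℝ) * x + f) / (2 * √(qD e f g x)))) x :=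
    ((hasDerivAt_qD e f g x).sqrt hD.ne').const_mul 2
  show ‖deriv (fun y => 2 * √(qD e f g y)) x‖ = |2 * (e : ℝ) * x + f| / √(qD e f g x)
  rw [hd.deriv, Real.norm_eq_abs,
    show (2 : ℝ) * ((2 * (e : ℝ) * x + f) / (2 * √(qD e f g x))) =
      (2 * (e : ℝ) * x + f) / √(qD e f g x) by field_simp,
    abs_div, abs_of_pos hs]

/-- Transport of integrability between `S ⊆ ℝ` and `{x | x 0 ∈ S} ⊆ ℝ¹` (file-local copy of
`KZ.integrableOn_setOf_apply_mem_iff`, `Literature/…/KZBetaChains`; part-local, `private`). [folklore] -/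
private theorem integrableOn_setOf_apply_mem_iff' {g : ℝ → ℝ} {S : Set ℝ} :
    IntegrableOn (fun x : Fin 1 → ℝ => g (x 0)) {x | x 0 ∈ S} ↔ IntegrableOn g S :=
  (volume_preserving_funUnique (Fin 1) ℝ).integrableOn_comp_preimage
    (MeasurableEquiv.funUnique (Fin 1) ℝ).measurableEmbedding

/-- **Integrability of `F/√D`** for `F` bounded and `ℚ`-semialgebraic on a `ℚ`-semialgebraic
`T ⊆ {D > 0} ∩ [lo, hi]` (`Δ ≠ 0`): dominated by `M·(A·|D′|/√D + B)`, transported to `ℝ¹` along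
`MeasurableEquiv.funUnique`. This is what makes the pieces `(αx + β)/√D` of a partial-fraction
split representations in their own right when the closure of `T` contains a root of `D`. [folklore] -/
theorem integrableOn_div_sqrt_qD (e f g : ℚ) (hΔ : f ^ 2 - 4 * e * g ≠ 0) (lo hi : ℝ)
    {T : Set (Fin 1 → ℝ)} (hT : IsSemialgebraic ℚ T)
    (hTsub : ∀ v ∈ T, lo ≤ v 0 ∧ v 0 ≤ hi ∧ 0 < qD e f g (v 0))
    {F : (Fin 1 → ℝ) → ℝ} (hF : IsSemialgebraicFunOn ℚ T F) (M : ℝ) (hM : ∀ v ∈ T, |F v| ≤ M) :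
    IntegrableOn (fun v => F v / √(qD e f g (v 0))) T := by
  obtain ⟨A, B, hA0, hB0, hdom⟩ := exists_dom_consts e f g hΔ
  obtain ⟨S, hSdef⟩ : ∃ S : Set ℝ, S = {x | 0 < qD e f g x} ∩ Icc lo hi := ⟨_, rfl⟩
  have hI : IntegrableOn (fun x => |2 * (e : ℝ) * x + f| / √(qD e f g x)) S := by
    rw [hSdef]; exact integrableOn_absDeriv_div_sqrt e f g lo hi
  have hSfin : volume S ≠ ⊤ := by
    rw [hSdef]
    exact ((measure_mono inter_subset_right).trans_lt measure_Icc_lt_top).ne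
  have hG : IntegrableOn
      (fun x => M * (A * (|2 * (e : ℝ) * x + f| / √(qD e f g x)) + B)) S :=
    ((hI.const_mul A).add (integrableOn_const (hs := hSfin) (C := B))).const_mul M
  have hG1 : IntegrableOn (fun v : Fin 1 → ℝ =>
      M * (A * (|2 * (e : ℝ) * v 0 + f| / √(qD e f g (v 0))) + B)) {v | v 0 ∈ S} :=
    (integrableOn_setOf_apply_mem_iff'
      (g := fun x => M * (A * (|2 * (e : ℝ) * x + f| / √(qD e f g x)) + B)) (S := S)).2 hG
  have hTS : T ⊆ {v | v 0 ∈ S} := fun v hv => by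
    rw [mem_setOf_eq, hSdef]
    exact ⟨(hTsub v hv).2.2, (hTsub v hv).1, (hTsub v hv).2.1⟩
  have hms : MeasurableSet T := hT.measurableSet_holds
  have hsa : IsSemialgebraicFunOn ℚ T fun v => F v / √(qD e f g (v 0)) :=
    hF.div (IsSemialgebraicFunOn.sqrt_holds (isSemialgebraicFunOn_qD e f g hT))
      fun v hv => (Real.sqrt_pos.2 (hTsub v hv).2.2).ne'
  refine Integrable.mono' (hG1.mono_set hTS) (KZ.aestronglyMeasurable_of_isSemialgebraicFunOn hsa hms)
    ((ae_restrict_mem hms).mono fun v hv => ?_)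
  have hD := (hTsub v hv).2.2
  have hs : 0 < √(qD e f g (v 0)) := Real.sqrt_pos.2 hD
  have hMv := hM v hv
  have hM0 : 0 ≤ M := (abs_nonneg _).trans hMv
  have h1 := hdom (v 0) hD
  rw [Real.norm_eq_abs, abs_div, abs_of_pos hs]
  calc |F v| / √(qD e f g (v 0)) ≤ M / √(qD e f g (v 0)) :=
        div_le_div_of_nonneg_right hMv hs.le
    _ = M * (1 / √(qD e f g (v 0))) := by ring
    _ ≤ M * ((A * |2 * (e : ℝ) * v 0 + f| + B * √(qD e f g (v 0))) / √(qD e f g (v 0))) :=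
        mul_le_mul_of_nonneg_left (div_le_div_of_nonneg_right h1 hs.le) hM0
    _ = M * (A * (|2 * (e : ℝ) * v 0 + f| / √(qD e f g (v 0))) + B) := by
        field_simp

/-- The representation `[T, Φ]` for an integrand `Φ = F/√D` on `T`, `F` bounded semialgebraic,
`T ⊆ {D > 0}` bounded (`Φ` is kept syntactically free so that the factor lemmas apply by `rfl`). -/
def sqrtDivRep (e f g : ℚ) (hΔ : f ^ 2 - 4 * e * g ≠ 0) (lo hi : ℝ) (T : Set (Fin 1 → ℝ))
    (hT : IsSemialgebraic ℚ T) (hTsub : ∀ v ∈ T, lo ≤ v 0 ∧ v 0 ≤ hi ∧ 0 < qD e f g (v 0))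
    (Φ F : (Fin 1 → ℝ) → ℝ) (hF : IsSemialgebraicFunOn ℚ T F) (M : ℝ) (hM : ∀ v ∈ T, |F v| ≤ M)
    (hΦ : ∀ v ∈ T, Φ v = F v / √(qD e f g (v 0))) : KZ.IntegralRep 1 where
  domain := T
  integrand := Φ
  isSemialgebraic_domain := hT
  isSemialgebraicFunOn_integrand :=
    (hF.div (IsSemialgebraicFunOn.sqrt_holds (isSemialgebraicFunOn_qD e f g hT))
      fun v hv => (Real.sqrt_pos.2 (hTsub v hv).2.2).ne').congr fun v hv => (hΦ v hv).symm
  integrableOn := (integrableOn_div_sqrt_qD e f g hΔ lo hi hT hTsub hF M hM).congr_fun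
    (fun v hv => (hΦ v hv).symm) hT.measurableSet_holds

/-- The domain of `sqrtDivRep` is `T`. -/
@[simp] theorem sqrtDivRep_domain (e f g : ℚ) (hΔ : f ^ 2 - 4 * e * g ≠ 0) (lo hi : ℝ)
    (T : Set (Fin 1 → ℝ)) (hT : IsSemialgebraic ℚ T)
    (hTsub : ∀ v ∈ T, lo ≤ v 0 ∧ v 0 ≤ hi ∧ 0 < qD e f g (v 0)) (Φ F : (Fin 1 → ℝ) → ℝ)
    (hF : IsSemialgebraicFunOn ℚ T F) (M : ℝ) (hM : ∀ v ∈ T, |F v| ≤ M)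
    (hΦ : ∀ v ∈ T, Φ v = F v / √(qD e f g (v 0))) :
    (sqrtDivRep e f g hΔ lo hi T hT hTsub Φ F hF M hM hΦ).domain = T := rfl

/-- The integrand of `sqrtDivRep` is `Φ`. -/
@[simp] theorem sqrtDivRep_integrand (e f g : ℚ) (hΔ : f ^ 2 - 4 * e * g ≠ 0) (lo hi : ℝ)
    (T : Set (Fin 1 → ℝ)) (hT : IsSemialgebraic ℚ T)
    (hTsub : ∀ v ∈ T, lo ≤ v 0 ∧ v 0 ≤ hi ∧ 0 < qD e f g (v 0)) (Φ F : (Fin 1 → ℝ) → ℝ)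
    (hF : IsSemialgebraicFunOn ℚ T F) (M : ℝ) (hM : ∀ v ∈ T, |F v| ≤ M)
    (hΦ : ∀ v ∈ T, Φ v = F v / √(qD e f g (v 0))) :
    (sqrtDivRep e f g hΔ lo hi T hT hTsub Φ F hF M hM hΦ).integrand = Φ := rfl

/-- `h ≠ 0` is `Δ ≠ 0` (`h = −Δ/(4e)`). -/
theorem disc_ne_zero {e f g : ℚ} (he : e ≠ 0) (hh : g - f ^ 2 / (4 * e) ≠ 0) :
    f ^ 2 - 4 * e * g ≠ 0 := by
  intro h0
  apply hh
  have : g - f ^ 2 / (4 * e) = -(f ^ 2 - 4 * e * g) / (4 * e) := by field_simp; ring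
  rw [this, h0, neg_zero, zero_div]

/-- On `{D > 0}`: `F/D·√D = F/√D`. -/
theorem div_mul_sqrt_eq {D : ℝ} (hD : 0 < D) (F : ℝ) : F / D * √D = F / √D := by
  have hs : √D ≠ 0 := (Real.sqrt_pos.2 hD).ne'
  rw [div_mul_eq_mul_div, div_eq_div_iff hD.ne' hs, mul_assoc, Real.mul_self_sqrt hD.le]

/-! #### 24.11 The factor `N(x)/D` on a bounded domain, the simple pole with `D(a) ≠ 0`, polynomial factors -/

/-- **The factor `N(x)/D`** (`N ∈ ℚ[x]`), i.e. the integrand `N/√D`, on a BOUNDED domain: these are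
the pieces of a partial-fraction split that blow up like `|x − α|^(−1/2)` at a boundary root `α` of
`D`; §24.10 makes them representations, the parity split about the vertex + `even_factor` /
`odd_factor` with `Q(s) = e·s + h = D` put them in the Baker sector. [this node] -/
theorem InBaker.inv_sqrt_factor (e f g : ℚ) (he : e ≠ 0) (hh : g - f ^ 2 / (4 * e) ≠ 0)
    (N : Polynomial ℚ) (lo hi : ℚ) (r : KZ.IntegralRep 1)
    (hdom : ∀ v ∈ r.domain, (lo : ℝ) ≤ v 0 ∧ v 0 ≤ hi)
    (hr : EqOn r.integrand
      (fun v => Polynomial.aeval (v 0) N / qD e f g (v 0) * √(qD e f g (v 0))) r.domain) :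
    InBaker (KZ.of r) := by
  have hΔ := disc_ne_zero he hh
  obtain ⟨X₀, hX₀def⟩ : ∃ X₀ : ℝ, X₀ = ((-f / (2 * e) : ℚ) : ℝ) := ⟨_, rfl⟩
  refine InBaker.restrict_pos e f g r _ hr fun r₁ hsub hpos hr₁ => ?_
  have hTsub : ∀ v ∈ r₁.domain, (lo : ℝ) ≤ v 0 ∧ v 0 ≤ hi ∧ 0 < qD e f g (v 0) :=
    fun v hv => ⟨(hdom v (hsub hv)).1, (hdom v (hsub hv)).2, hpos v hv⟩
  -- parity split of the numerator about the vertex: N(x) = E((x − x₀)²) + (x − x₀)·O((x − x₀)²)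
  obtain ⟨E, hEdef⟩ : ∃ E : Polynomial ℚ, E = Parity.ev (Parity.sh (-f / (2 * e)) N) := ⟨_, rfl⟩
  obtain ⟨O, hOdef⟩ : ∃ O : Polynomial ℚ, O = Parity.od (Parity.sh (-f / (2 * e)) N) := ⟨_, rfl⟩
  have hN : ∀ x : ℝ, Polynomial.aeval x N =
      Polynomial.aeval ((x - X₀) ^ 2) E + (x - X₀) * Polynomial.aeval ((x - X₀) ^ 2) O := by
    intro x
    have h1 := Parity.aeval_sh (-f / (2 * e)) N (x - X₀)
    rw [← hX₀def, show X₀ + (x - X₀) = x by ring] at h1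
    rw [← h1, Parity.aeval_eq, hEdef, hOdef]
  -- the even denominator `Q(s) = e·s + h` evaluates to `D`
  obtain ⟨Qv, hQvdef⟩ : ∃ Qv : Polynomial ℚ,
      Qv = Polynomial.C e * Polynomial.X + Polynomial.C (g - f ^ 2 / (4 * e)) := ⟨_, rfl⟩
  have hQv : ∀ x : ℝ, Polynomial.aeval ((x - X₀) ^ 2) Qv = qD e f g x := by
    intro x
    rw [hQvdef, map_add, map_mul, Polynomial.aeval_C, Polynomial.aeval_X, Polynomial.aeval_C,
      eq_ratCast, eq_ratCast, qD_eq_vertex e f g he x, hX₀def]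
  have hQne : ∀ v ∈ r₁.domain, Polynomial.aeval ((v 0 - ((-f / (2 * e) : ℚ) : ℝ)) ^ 2) Qv ≠ 0 := by
    intro v hv; rw [← hX₀def, hQv]; exact (hpos v hv).ne'
  -- the even piece as a representation of its own (§24.10)
  have hcont : Continuous fun x : ℝ => Polynomial.aeval ((x - X₀) ^ 2) E := by fun_prop
  obtain ⟨M, hM⟩ :=
    (isCompact_Icc : IsCompact (Icc (lo : ℝ) hi)).exists_bound_of_continuousOn hcont.continuousOn
  have hFe : IsSemialgebraicFunOn ℚ r₁.domain fun v => Polynomial.aeval ((v 0 - X₀) ^ 2) E := by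
    have h := (((IsRatOn.coord.sub (IsRatOn.const (-f / (2 * e)))).pow 2).polyAeval E).isSemialgebraicFunOn
      r₁.isSemialgebraic_domain
    rw [← hX₀def] at h
    exact h
  obtain ⟨rE, hrEdef⟩ : ∃ rE : KZ.IntegralRep 1, rE = sqrtDivRep e f g hΔ lo hi r₁.domain
      r₁.isSemialgebraic_domain hTsub
      (fun v => Polynomial.aeval ((v 0 - ((-f / (2 * e) : ℚ) : ℝ)) ^ 2) E /
        Polynomial.aeval ((v 0 - ((-f / (2 * e) : ℚ) : ℝ)) ^ 2) Qv * √(qD e f g (v 0)))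
      _ hFe M
      (fun v hv => by
        rw [← Real.norm_eq_abs]; exact hM (v 0) ⟨(hTsub v hv).1, (hTsub v hv).2.1⟩)
      (fun v hv => by rw [← hX₀def, hQv, div_mul_sqrt_eq (hpos v hv)]) := ⟨_, rfl⟩
  have hdomE : rE.domain = r₁.domain := by rw [hrEdef]; rfl
  have hintE : rE.integrand = fun v => Polynomial.aeval ((v 0 - ((-f / (2 * e) : ℚ) : ℝ)) ^ 2) E /
      Polynomial.aeval ((v 0 - ((-f / (2 * e) : ℚ) : ℝ)) ^ 2) Qv * √(qD e f g (v 0)) := by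
    rw [hrEdef]; rfl
  refine InBaker.of_sub' r₁ rE hdomE ?_ ?_
  · exact InBaker.even_factor e f g he hh E Qv rE (fun v hv => hQne v (hdomE ▸ hv))
      fun v _ => by rw [hintE]
  · refine InBaker.odd_factor e f g he O Qv (subRep r₁ rE hdomE) hQne fun v hv => ?_
    have hv' : v ∈ r₁.domain := hv
    have hD : qD e f g (v 0) ≠ 0 := (hpos v hv').ne'
    rw [subRep_integrand, hintE, hr₁ hv']
    beta_reduce
    rw [← hX₀def, hQv, hN (v 0)]
    field_simp
    ring

/-- **The simple pole `c·√D/(x − a)` with `D(a) ≠ 0`** on a BOUNDED domain: partial fractions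
`c/(x − a) = c(e·x + e·a + f)/D + c·D(a)/((x − a)·D)`; the first piece is `inv_sqrt_factor`
(a representation by §24.10), the second — as the DIFFERENCE representation — is `mirror_atom`.
Together with `root_pole_atom` (`D(a) = 0`, any domain): every simple rational pole. [this node] -/
theorem InBaker.simple_pole (e f g a c : ℚ) (he : e ≠ 0) (hh : g - f ^ 2 / (4 * e) ≠ 0)
    (hDa : e * a ^ 2 + f * a + g ≠ 0) (lo hi : ℚ) (r : KZ.IntegralRep 1)
    (hdom : ∀ v ∈ r.domain, (lo : ℝ) ≤ v 0 ∧ v 0 ≤ hi)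
    (hr : EqOn r.integrand (fun v => (c : ℝ) / (v 0 - a) * √(qD e f g (v 0))) r.domain) :
    InBaker (KZ.of r) := by
  have hΔ := disc_ne_zero he hh
  refine InBaker.restrict_pos e f g r _ hr fun r₁ hsub hpos hr₁ => ?_
  -- off the point `a` (removed by a split there) the partial-fraction identity holds pointwise
  have piece : ∀ r₂ : KZ.IntegralRep 1, r₂.domain ⊆ r₁.domain → (∀ v ∈ r₂.domain, v 0 ≠ (a : ℝ)) →
      r₂.integrand = r₁.integrand → InBaker (KZ.of r₂) := by
    intro r₂ hsub₂ hne hi₂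
    have hTsub : ∀ v ∈ r₂.domain, (lo : ℝ) ≤ v 0 ∧ v 0 ≤ hi ∧ 0 < qD e f g (v 0) :=
      fun v hv => ⟨(hdom v (hsub (hsub₂ hv))).1, (hdom v (hsub (hsub₂ hv))).2, hpos v (hsub₂ hv)⟩
    obtain ⟨N₁, hN₁def⟩ : ∃ N₁ : Polynomial ℚ,
        N₁ = Polynomial.C (c * e) * Polynomial.X + Polynomial.C (c * (e * a + f)) := ⟨_, rfl⟩
    have hN₁ : ∀ x : ℝ, Polynomial.aeval x N₁ = (c : ℝ) * ((e : ℝ) * x + (e * a + f)) := by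
      intro x
      rw [hN₁def, map_add, map_mul, Polynomial.aeval_C, Polynomial.aeval_X, Polynomial.aeval_C,
        eq_ratCast, eq_ratCast]
      push_cast
      ring
    have hcont : Continuous fun x : ℝ => Polynomial.aeval x N₁ := by fun_prop
    obtain ⟨M, hM⟩ :=
      (isCompact_Icc : IsCompact (Icc (lo : ℝ) hi)).exists_bound_of_continuousOn hcont.continuousOn
    have hF₁ : IsSemialgebraicFunOn ℚ r₂.domain fun v => Polynomial.aeval (v 0) N₁ :=
      (IsRatOn.coord.polyAeval N₁).isSemialgebraicFunOn r₂.isSemialgebraic_domain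
    obtain ⟨r₃, hr₃def⟩ : ∃ r₃ : KZ.IntegralRep 1, r₃ = sqrtDivRep e f g hΔ lo hi r₂.domain
        r₂.isSemialgebraic_domain hTsub
        (fun v => Polynomial.aeval (v 0) N₁ / qD e f g (v 0) * √(qD e f g (v 0))) _ hF₁ M
        (fun v hv => by
          rw [← Real.norm_eq_abs]; exact hM (v 0) ⟨(hTsub v hv).1, (hTsub v hv).2.1⟩)
        (fun v hv => by rw [div_mul_sqrt_eq (hTsub v hv).2.2]) := ⟨_, rfl⟩
    have hdom₃ : r₃.domain = r₂.domain := by rw [hr₃def]; rfl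
    have hint₃ : r₃.integrand =
        fun v => Polynomial.aeval (v 0) N₁ / qD e f g (v 0) * √(qD e f g (v 0)) := by
      rw [hr₃def]; rfl
    refine InBaker.of_sub' r₂ r₃ hdom₃ ?_ ?_
    · exact InBaker.inv_sqrt_factor e f g he hh N₁ lo hi r₃
        (fun v hv => ⟨(hTsub v (hdom₃ ▸ hv)).1, (hTsub v (hdom₃ ▸ hv)).2.1⟩)
        fun v _ => by rw [hint₃]
    · refine InBaker.mirror_atom e f g a (c * (e * a ^ 2 + f * a + g)) he hh hDa
        (subRep r₂ r₃ hdom₃) fun v hv => ?_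
      have hv' : v ∈ r₂.domain := hv
      have hxa : v 0 - (a : ℝ) ≠ 0 := sub_ne_zero.2 (hne v hv')
      have hD : qD e f g (v 0) ≠ 0 := (hpos v (hsub₂ hv')).ne'
      rw [subRep_integrand, hint₃, hi₂, hr₁ (hsub₂ hv')]
      show (c : ℝ) / (v 0 - a) * √(qD e f g (v 0)) -
          Polynomial.aeval (v 0) N₁ / qD e f g (v 0) * √(qD e f g (v 0)) =
        ((c * (e * a ^ 2 + f * a + g) : ℚ) : ℝ) / ((v 0 - a) * qD e f g (v 0)) * √(qD e f g (v 0))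
      rw [hN₁]
      push_cast
      field_simp
      simp only [qD]
      ring
  refine InBaker.of_split_at a r₁ (fun r₂ hd₂ hi₂ => piece r₂ ?_ ?_ hi₂)
    fun r₂ hd₂ hi₂ => piece r₂ ?_ ?_ hi₂
  · intro v hv; rw [hd₂] at hv; exact hv.1
  · intro v hv; rw [hd₂] at hv; exact hv.2.ne'
  · intro v hv; rw [hd₂] at hv; exact hv.1
  · intro v hv; rw [hd₂] at hv; exact hv.2.ne

/-- **Polynomial factor `N(x)·√D`** on a bounded domain: `euler_factor` with `Q = 1`. [this node] -/
theorem InBaker.poly_factor (e f g : ℚ) (he : e ≠ 0) (hh : g - f ^ 2 / (4 * e) ≠ 0)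
    (N : Polynomial ℚ) (lo hi : ℚ) (r : KZ.IntegralRep 1)
    (hdom : ∀ v ∈ r.domain, (lo : ℝ) ≤ v 0 ∧ v 0 ≤ hi)
    (hr : EqOn r.integrand (fun v => Polynomial.aeval (v 0) N * √(qD e f g (v 0))) r.domain) :
    InBaker (KZ.of r) :=
  InBaker.euler_factor e f g he hh N 1 lo hi r hdom (fun x _ _ => by simp) fun v hv => by
    rw [hr hv]; simp only [map_one, div_one]

/-! #### 24.12 Bookkeeping: distinct simple rational poles (partial fractions, by induction) -/

/-- `∏_{b ∈ l} (x − b) ≠ 0` off the points of `l`. -/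
theorem list_prod_sub_ne_zero (l : List ℚ) (x : ℝ) (h : ∀ b ∈ l, x ≠ (b : ℝ)) :
    (l.map fun b : ℚ => x - (b : ℝ)).prod ≠ 0 := by
  induction l with
  | nil => simp
  | cons b rest ih =>
    rw [List.map_cons, List.prod_cons]
    exact mul_ne_zero (sub_ne_zero.2 (h b (by simp)))
      (ih fun b' hb' => h b' (List.mem_cons_of_mem b hb'))

/-- `aeval x ∏ (X − C b) = ∏ (x − b)`. -/
theorem aeval_prodX (l : List ℚ) (x : ℝ) :
    Polynomial.aeval x (l.map fun b => Polynomial.X - Polynomial.C b).prod =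
      (l.map fun b : ℚ => x - (b : ℝ)).prod := by
  induction l with
  | nil => simp
  | cons b rest ih =>
    rw [List.map_cons, List.prod_cons, List.map_cons, List.prod_cons, map_mul, ih, map_sub,
      Polynomial.aeval_X, Polynomial.aeval_C, eq_ratCast]

/-- `(∏ (X − C b)).eval a ≠ 0` for `a ∉ l`. -/
theorem eval_prodX_ne_zero (l : List ℚ) (a : ℚ) (ha : a ∉ l) :
    ((l.map fun b => Polynomial.X - Polynomial.C b).prod).eval a ≠ 0 := by
  induction l with
  | nil => simp
  | cons b rest ih =>
    rw [List.map_cons, List.prod_cons, Polynomial.eval_mul, Polynomial.eval_sub,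
      Polynomial.eval_X, Polynomial.eval_C]
    exact mul_ne_zero (sub_ne_zero.2 fun h => ha (h ▸ by simp))
      (ih fun h => ha (List.mem_cons_of_mem b h))

end Summit.KontsevichZagierPeriods.RootDecompWalshStrata.ConicDescent
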